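import Mathlib.Analysis.Calculus.Deriv.Mul
import Mathlib.Analysis.Calculus.Deriv.Add
import Mathlib.Data.Matrix.Basic
import Mathlib.Data.Matrix.Mul
import Mathlib.Analysis.Complex.Basic
import HarnessLib

/-!
# Stub `stub_supertrace_prod_hasDerivAt` of line `pin-the-infimum` (crux `RobustYangMillsHandover`, 8892)

E2, layer W2-1b of the fermionic-insertion bricks in Lüscher's transfer-matrix representation of
the QCD torus functional. Lüscher's transfer form writes the Wilson fermion determinant as a
SUPERTRACE `STr X = ∑_S (-1)^{#S} X_{SS}` of an ordered product over time slices
`∏_{i<T} Γ(N_i)` of Fock-space matrices (index type `Finset ι`). A quark-bilinear source at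
slice `t₀ < T` makes exactly ONE factor depend on a real parameter `s` (`γ s`, with
`γ s₀ = M t₀`), all others being constant. This file is the calculus bookkeeping, entrywise
(complex-valued functions of the real parameter, no matrix norm):

1. the product rule for matrix-valued paths, `d/ds (P Q)|_{s₀} = P' Q(s₀) + P(s₀) Q'`;
2. the derivative of the ordered product `∏_{i<T} (if i = t₀ then γ s else M i)` is the same
   product with the `t₀`-th factor replaced by its derivative `γ'` (the product is linear in
   each factor; all factors but the `t₀`-th are constant) — this needs the factor to be PRESENT,
   i.e. `t₀ < T` (for `T ≤ t₀` the path is constant while the stated value is `∏_{i<T} M i`);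
3. hence the derivative of the supertrace `∑_S (-1)^{#S} (∏ …)_{SS}` (finite sum of constant
   multiples of 2.).

## Proof

1. Entry `(S, S')` of `P(s) Q(s)` is `∑_K P(s)_{SK} Q(s)_{KS'}` (`Matrix.mul_apply`); the scalar
product rule `HasDerivAt.fun_mul` and the sum rule `HasDerivAt.fun_sum` give the derivative
`∑_K (P'_{SK} Q(s₀)_{KS'} + P(s₀)_{SK} Q'_{KS'}) = (P' Q(s₀) + P(s₀) Q')_{SS'}`.
2. Induction on `T`, peeling off the last factor with `List.range_succ`: if the new last index
`T` is not `t₀` the new factor `M T` is constant (1. with `Q' = 0` and the induction hypothesis);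
if `T = t₀` the product over `range t₀` contains no perturbed factor, so it is a constant `C`
and the path is `C γ(s)` (1. with `P' = 0`).
3. `HasDerivAt.const_mul` and `HasDerivAt.fun_sum` over `S : Finset ι`.

References: J. R. Magnus, H. Neudecker, *Matrix Differential Calculus*, 3rd ed. (Wiley 2019),
Ch. 8 (product rule for matrix functions); D. S. Bernstein, *Matrix Mathematics*, 2nd ed.
(Princeton 2009), §10.6 (derivative of a product of matrix functions); M. Lüscher, Comm. Math.
Phys. 54 (1977) 283 (transfer-matrix representation of the lattice fermion determinant).
What is NOT here: any statement about the transfer matrices themselves (`Γ`, `dΓ`, Fock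
spaces) — this is pure finite-dimensional calculus of a real variable.
-/

namespace Summit.QuantumFields.QCD.Cruxes.RobustYangMillsHandover.PinTheInfimum

namespace StubSupertraceProdHasDerivAt

variable {n : Type*} [Fintype n]

/-- **Entrywise product rule for matrix-valued paths of a real parameter**: if every entry of
`P` (resp. `Q`) has derivative the corresponding entry of `P'` (resp. `Q'`) at `s₀`, then every
entry of `s ↦ P(s) Q(s)` has derivative the corresponding entry of `P' Q(s₀) + P(s₀) Q'` at `s₀`
(`Matrix.mul_apply`, `HasDerivAt.fun_mul`, `HasDerivAt.fun_sum`). [folklore] -/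
theorem hasDerivAt_mul_apply {P Q : ℝ → Matrix n n ℂ} {P' Q' : Matrix n n ℂ} {s₀ : ℝ}
    (hP : ∀ S S', HasDerivAt (fun s => P s S S') (P' S S') s₀)
    (hQ : ∀ S S', HasDerivAt (fun s => Q s S S') (Q' S S') s₀) (S S' : n) :
    HasDerivAt (fun s => (P s * Q s) S S') ((P' * Q s₀ + P s₀ * Q') S S') s₀ := by
  have hfun : (fun s => (P s * Q s) S S') = fun s => ∑ K, P s S K * Q s K S' := by
    funext s
    rw [Matrix.mul_apply]
  rw [hfun]
  refine (HasDerivAt.fun_sum (u := Finset.univ)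
    fun K _ => (hP S K).fun_mul (hQ K S')).congr_deriv ?_
  rw [Matrix.add_apply, Matrix.mul_apply, Matrix.mul_apply, ← Finset.sum_add_distrib]

omit [Fintype n] in
/-- **Entries of a constant matrix path have derivative `0 = (0 : Matrix) S S'`.** [folklore] -/
theorem hasDerivAt_const_apply (C : Matrix n n ℂ) (s₀ : ℝ) (S S' : n) :
    HasDerivAt (fun _ : ℝ => C S S') ((0 : Matrix n n ℂ) S S') s₀ :=
  (hasDerivAt_const s₀ (C S S')).congr_deriv (Matrix.zero_apply S S').symm

/-- **Constant left factor**: entrywise, `d/ds (C Q(s))|_{s₀} = C Q'` (the product rule with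
`P' = 0`). [folklore] -/
theorem hasDerivAt_const_mul_apply (C : Matrix n n ℂ) {Q : ℝ → Matrix n n ℂ} {Q' : Matrix n n ℂ}
    {s₀ : ℝ} (hQ : ∀ S S', HasDerivAt (fun s => Q s S S') (Q' S S') s₀) (S S' : n) :
    HasDerivAt (fun s => (C * Q s) S S') ((C * Q') S S') s₀ := by
  refine (hasDerivAt_mul_apply (P := fun _ => C) (hasDerivAt_const_apply C s₀) hQ S S').congr_deriv
    ?_
  rw [zero_mul, zero_add]

/-- **Constant right factor**: entrywise, `d/ds (P(s) C)|_{s₀} = P' C` (the product rule with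
`Q' = 0`). [folklore] -/
theorem hasDerivAt_mul_const_apply {P : ℝ → Matrix n n ℂ} {P' : Matrix n n ℂ} (C : Matrix n n ℂ)
    {s₀ : ℝ} (hP : ∀ S S', HasDerivAt (fun s => P s S S') (P' S S') s₀) (S S' : n) :
    HasDerivAt (fun s => (P s * C) S S') ((P' * C) S S') s₀ := by
  refine (hasDerivAt_mul_apply (Q := fun _ => C) hP (hasDerivAt_const_apply C s₀) S S').congr_deriv
    ?_
  rw [mul_zero, add_zero]

/-- **The factors before slot `t₀` are unperturbed**: on `List.range t₀` no index equals `t₀`,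
so replacing the `t₀`-th value of `M` changes nothing there. [folklore] -/
theorem map_range_ite_eq {α : Type*} (M : ℕ → α) (t₀ : ℕ) (X : α) :
    ((List.range t₀).map fun i : ℕ => if i = t₀ then X else M i) = (List.range t₀).map M := by
  apply List.map_congr_left
  intro i hi
  rw [List.mem_range] at hi
  rw [if_neg (Nat.ne_of_lt hi)]

/-- **Peeling off an unperturbed last factor**: for `T ≠ t₀`,
`∏_{i<T+1} (if i = t₀ then X else M i) = (∏_{i<T} (if i = t₀ then X else M i)) * M T`
(`List.range_succ`). [folklore] -/
theorem prod_map_range_succ_of_ne {α : Type*} [Monoid α] (M : ℕ → α) {T t₀ : ℕ} (hT : T ≠ t₀)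
    (X : α) :
    ((List.range (T + 1)).map fun i : ℕ => if i = t₀ then X else M i).prod =
      ((List.range T).map fun i : ℕ => if i = t₀ then X else M i).prod * M T := by
  rw [List.range_succ, List.map_append, List.map_singleton, List.prod_append, List.prod_singleton,
    if_neg hT]

/-- **Peeling off the perturbed last factor**:
`∏_{i<t₀+1} (if i = t₀ then X else M i) = (∏_{i<t₀} M i) * X`. [folklore] -/
theorem prod_map_range_succ_self {α : Type*} [Monoid α] (M : ℕ → α) (t₀ : ℕ) (X : α) :
    ((List.range (t₀ + 1)).map fun i : ℕ => if i = t₀ then X else M i).prod =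
      ((List.range t₀).map M).prod * X := by
  rw [List.range_succ, List.map_append, List.map_singleton, List.prod_append, List.prod_singleton,
    if_pos rfl, map_range_ite_eq]

/-- **Derivative of an ordered matrix product with one varying factor** (entrywise): if every
entry of `γ` has derivative the corresponding entry of `γ'` at `s₀` and `t₀ < T`, then every
entry of `s ↦ ∏_{i<T} (if i = t₀ then γ s else M i)` has derivative the corresponding entry of
`∏_{i<T} (if i = t₀ then γ' else M i)` at `s₀` — induction on `T`, peeling off the last factor,
which is either the constant `M T` (`T ≠ t₀`, right-constant product rule) or `γ s` itself
(`T = t₀`, left-constant product rule, the earlier factors being unperturbed). [folklore] -/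
theorem hasDerivAt_prod_map_range_apply [DecidableEq n] (M : ℕ → Matrix n n ℂ)
    {γ : ℝ → Matrix n n ℂ} {γ' : Matrix n n ℂ} {s₀ : ℝ} {t₀ : ℕ}
    (hγ : ∀ S S', HasDerivAt (fun s => γ s S S') (γ' S S') s₀) :
    ∀ {T : ℕ}, t₀ < T → ∀ S S',
      HasDerivAt
        (fun s => ((List.range T).map fun i : ℕ => if i = t₀ then γ s else M i).prod S S')
        (((List.range T).map fun i : ℕ => if i = t₀ then γ' else M i).prod S S') s₀ := by
  intro T
  induction T with
  | zero => exact fun h => absurd h (Nat.not_lt_zero t₀)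
  | succ T ih =>
    intro hT S S'
    rcases Nat.lt_or_eq_of_le (Nat.le_of_lt_succ hT) with hlt | heq
    · -- the new last factor `M T` is unperturbed (`T ≠ t₀`)
      simp_rw [prod_map_range_succ_of_ne M (Nat.ne_of_gt hlt)]
      exact hasDerivAt_mul_const_apply (M T) (ih hlt) S S'
    · -- the new last factor is the perturbed one (`T = t₀`); the earlier ones are constant
      subst heq
      simp_rw [prod_map_range_succ_self]
      exact hasDerivAt_const_mul_apply _ hγ S S'

end StubSupertraceProdHasDerivAt

/-- **E2 W2-1b: differentiating a supertrace of a transfer product with one varying factor.**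
For Fock-space matrices indexed by `Finset ι`, constant slices `M i`, and a slice-`t₀` path `γ`
(real parameter) with entrywise derivative `γ'` at `s₀`, `γ s₀ = M t₀`, and `t₀ < T`:
(1) the entrywise product rule `d/ds (P Q)|_{s₀} = P' Q(s₀) + P(s₀) Q'` for matrix-valued paths;
(2) `d/ds ∏_{i<T} (if i = t₀ then γ s else M i) |_{s₀} = ∏_{i<T} (if i = t₀ then γ' else M i)`
entrywise (the ordered product is linear in its `t₀`-th factor, the others are constant);
(3) hence `d/ds STr(∏ …)|_{s₀} = STr(∏_{i<T} (if i = t₀ then γ' else M i))`, where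
`STr X = ∑_S (-1)^{#S} X_{SS}` is the supertrace (Magnus–Neudecker, *Matrix Differential
Calculus*, Ch. 8; Lüscher 1977 for the transfer form). The hypothesis `t₀ < T` is necessary:
for `T ≤ t₀` the path in (2) is constant while the stated derivative is `∏_{i<T} M i`
(e.g. `T = 0`: derivative `0`, stated value `1`). [folklore] -/
theorem stub_supertrace_prod_hasDerivAt :
    ∀ (ι : Type) [LinearOrder ι] [Fintype ι] (T t₀ : ℕ) (M : ℕ → Matrix (Finset ι) (Finset ι) ℂ)
      (γ : ℝ → Matrix (Finset ι) (Finset ι) ℂ) (γ' : Matrix (Finset ι) (Finset ι) ℂ) (s₀ : ℝ),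
      (∀ S S', HasDerivAt (fun s => γ s S S') (γ' S S') s₀) → γ s₀ = M t₀ → t₀ < T →
      (∀ (P Q : ℝ → Matrix (Finset ι) (Finset ι) ℂ) (P' Q' : Matrix (Finset ι) (Finset ι) ℂ),
        (∀ S S', HasDerivAt (fun s => P s S S') (P' S S') s₀) →
        (∀ S S', HasDerivAt (fun s => Q s S S') (Q' S S') s₀) →
        ∀ S S', HasDerivAt (fun s => (P s * Q s) S S') ((P' * Q s₀ + P s₀ * Q') S S') s₀) ∧
      (∀ S S', HasDerivAt (fun s => (((List.range T).map fun i : ℕ => if i = t₀ then γ s else M i).prod) S S')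
        ((((List.range T).map fun i : ℕ => if i = t₀ then γ' else M i).prod) S S') s₀) ∧
      HasDerivAt (fun s => ∑ S : Finset ι, (-1 : ℂ) ^ S.card *
          (((List.range T).map fun i : ℕ => if i = t₀ then γ s else M i).prod) S S)
        (∑ S : Finset ι, (-1 : ℂ) ^ S.card * (((List.range T).map fun i : ℕ => if i = t₀ then γ' else M i).prod) S S) s₀ := by
  intro ι _ _ T t₀ M γ γ' s₀ hγ _ hT
  have h2 := StubSupertraceProdHasDerivAt.hasDerivAt_prod_map_range_apply M hγ hT
  refine ⟨fun P Q P' Q' hP hQ S S' =>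
    StubSupertraceProdHasDerivAt.hasDerivAt_mul_apply hP hQ S S', h2, ?_⟩
  exact HasDerivAt.fun_sum (u := Finset.univ) fun S _ => (h2 S S).const_mul ((-1 : ℂ) ^ S.card)

end Summit.QuantumFields.QCD.Cruxes.RobustYangMillsHandover.PinTheInfimum
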